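import Summits.QuantumFields.YangMills.Theorems.AlphaInputsT3ACv3EMLIterFirstOrderUniformAllL
import Summits.QuantumFields.YangMills.Theorems.AlphaInputsT3ACv3SmoothLiftCandidate
import HarnessLib

/-!
# `AlphaInputsT3ACv3SmoothLiftCandidateAllL` — ★w2 g2's SMOOTH-LIFT CANDIDATE (`SmoothLiftCandidate.norm_iter_cand_sub_one_sub_le` ∕ `exists_smoothLiftCandidate`, the per-stencil
# START ∕ zeroth Newton iterate of the (FL) route) AT **EVERY** BLOCK SIZE `L ≥ 2`: the proviso `d + 2 ≤ L` (inherited from ★w1's R1) is removed by calling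
# `EMLIterUniformAllL.norm_iter_sub_one_sub_iterLin_le_uniform_allL` (Duhamel form, p593768) — so the candidate's «averages = 1 + A + O(M²), k-uniformly» holds at `L = 3`, which
# `HistoryTailL` ∕ `FluctuationComparisonRegPrIntL` ∕ 2′χ need (`∀ odd L > 1`) — cell `ym3-torus`, width seat `ym-ust-19936-w5` (g0); fifth file of the `…AllL` set (★w2 g2 01:54Z: «at
# L = 3 swap R1 for your AllL row — mechanical»)

WHAT.  ★w2's statements and proofs VERBATIM with the R1 call replaced: scales WITHOUT the group-dimension factor (`m_k = (d+1)L^kδ = 2(d+1)·C_S·M`, k-free because the lift is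
`L^{−k}`-small), rows `C'·(2(d+1)C_S M) ≤ 1`, `32ℓ·(2(d+1)C_S M) ≤ 1`, `4ℓ·(2(d+1)C_S M) < δ_SU` with `C' = (d+1)·18^d(2+(d+1)18^d)·324ℓ²/(L(L−1))`; conclusions
`‖Ū^{(k)}(c) − 1‖ ≤ 4(d+1)C_S·M` and `‖Ū^{(k)}(c) − 1 − A(c)‖ ≤ (C'·(2(d+1)C_S)² + (d+1)C_S²)·M²`; `exists_smoothLiftCandidate_allL` with (i) bond variables within `2C_S M/L^k` of `1`,
(ii) ALL finest plaquettes within `(4·18^d·M + 16(C_S M)²)/(L^k)²` (★w2's `dist1_plaqHol_cand_le`, unchanged), (iii) the averages row above — NO `L`-threshold.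
HONEST FRAMING.  Bookkeeping over landed lemmas (★w2 g2's `cand` ∕ `norm_coe_cand_sub_one_le` ∕ `dist1_plaqHol_cand_le`, ★w3's `liftSM` ∕ `avgCLM`, this seat's R1-allL); (FL)∕`hLift`∕KIN
NOT proved; count-neutral helper toward R3 2′∕2′χ (`--supports stmt-QuantumFields-19936`); registry untouched; nothing about d = 4, the continuum, or a mass gap; YM₃ on T³ is rung R3,
not Clay.

References: T. Bałaban, Commun. Math. Phys. 102 (1985) 277–309 [Balaban1985Variational] (Thm 1 (8) p.279); Commun. Math. Phys. 98 (1985) 17–51 [Balaban1985Averaging] (Prop. 4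
(134)–(135) p.38); CMP 109 (1987) 249–301 [Balaban1987RG1] ((0.4), (0.11) p.253).
-/

set_option autoImplicit false

noncomputable section

open scoped Matrix.Norms.L2Operator
open NormedSpace

namespace Summit.QuantumFields.YangMills.Theorems.SmoothLiftCandidate

open Literature.MathematicalPhysics.QuantumFieldTheory.Balaban1983to89
open T4Continuum AveragingRT BlockAveraging ExpMeanLog BlockAveragingEMLLinearised
open Literature.MathematicalPhysics.QuantumFieldTheory.Balaban1983to89.T4AdjointCovarianceUnitary (lieSU expSU coe_expSU mem_lieSU_iff)
open Summit.QuantumFields.YangMills.Theorems.LinearLiftMatrix (liftSM liftSM_mem norm_liftSM_le linAvgIterM linAvgIterM_zero linAvgIterM_succ linAvgIterM_liftSM CS CS_nonneg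
  avgCLM avgCLM_apply norm_avgCLM_le)
open Summit.QuantumFields.YangMills.Theorems.EMLIterUniformAllL (norm_iter_sub_one_sub_iterLin_le_uniform_allL)

variable {P : Params} {n : Type*} [Fintype n] [DecidableEq n] [Nonempty n]
variable (k : ℕ) (hk : k ≤ P.m + P.K)

include hk in
/-- ★★ **(iii) AT EVERY BLOCK SIZE `L ≥ 2`: THE CANDIDATE'S `k`-FOLD (0.4) AVERAGES ARE `1 + A + O(M²)` WITH A `k`-FREE, `L`-THRESHOLD-FREE CONSTANT** —
`‖Ū^{(k)}(c) − 1‖ ≤ 4(d+1)C_S·M` and `‖Ū^{(k)}(c) − 1 − A(c)‖ ≤ (C'·(2(d+1)C_S)² + (d+1)·C_S²)·M²` (★w2 g2's `norm_iter_cand_sub_one_sub_le` with this seat's R1-allL in place of R1;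
guards `C_S·M ≤ 1`, `C'·(2(d+1)C_S M) ≤ 1`, `32ℓ·(2(d+1)C_S M) ≤ 1`, `4ℓ·(2(d+1)C_S M) < δ_SU`). [cite: Balaban1985Averaging, Prop. 4 (134)–(135) p.38; Balaban1987RG1, (0.4)+(0.11) p.253] -/
theorem norm_iter_cand_sub_one_sub_le_allL (A : PBond P k → Matrix n n ℂ) (hA : ∀ c, A c ∈ lieSU n) {M : ℝ} (hM : ∀ c, ‖A c‖ ≤ M) (hM1 : CS P * M ≤ 1)
    (hm : (((P.d : ℝ) + 1) * ((18 : ℝ) ^ P.d * (2 + ((P.d : ℝ) + 1) * (18 : ℝ) ^ P.d)) * (324 * (((P.d + 2) * P.L : ℕ) : ℝ) ^ 2) / ((P.L : ℝ) * ((P.L : ℝ) - 1))) * (2 * (((P.d : ℝ) + 1) * (CS P * M))) ≤ 1)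
    (h32 : 32 * (((P.d + 2) * P.L : ℕ) : ℝ) * (2 * (((P.d : ℝ) + 1) * (CS P * M))) ≤ 1)
    (hN : 4 * (((P.d + 2) * P.L : ℕ) : ℝ) * (2 * (((P.d : ℝ) + 1) * (CS P * M))) < deltaSU n) (c : PBond P k) :
    ‖((Averaging.iter (fun i => blockAvg (P := P) (j := i) (expMeanLogSU (n := n))) k (cand k A hA) c : Matrix.specialUnitaryGroup n ℂ) : Matrix n n ℂ) - 1‖ ≤ 2 * (2 * (((P.d : ℝ) + 1) * (CS P * M))) ∧
    ‖((Averaging.iter (fun i => blockAvg (P := P) (j := i) (expMeanLogSU (n := n))) k (cand k A hA) c : Matrix.specialUnitaryGroup n ℂ) : Matrix n n ℂ) - 1 - A c‖ ≤ ((((P.d : ℝ) + 1) * ((18 : ℝ) ^ P.d * (2 + ((P.d : ℝ) + 1) * (18 : ℝ) ^ P.d)) * (324 * (((P.d + 2) * P.L : ℕ) : ℝ) ^ 2) / ((P.L : ℝ) * ((P.L : ℝ) - 1))) * (2 * (((P.d : ℝ) + 1) * CS P)) ^ 2 + ((P.d : ℝ) + 1) * CS P ^ 2) * M ^ 2 :=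 by
  have hM0 : 0 ≤ M := (norm_nonneg _).trans (hM c)
  have hCS := CS_nonneg P
  have hLpos : (0 : ℝ) < P.L := by exact_mod_cast P.L_pos
  have hLk : (0 : ℝ) < (P.L : ℝ) ^ k := pow_pos hLpos k
  have hL1 : (1 : ℝ) ≤ (P.L : ℝ) ^ k := one_le_pow₀ (by exact_mod_cast P.hL.2.le)
  set U := cand k A hA with hU
  set a : PBond P 0 → Matrix n n ℂ := liftSM k A with ha
  set α : ℝ := CS P * M / (P.L : ℝ) ^ k with hα
  have hα0 : 0 ≤ α := by positivity
  -- (i): the candidate is `2α`-close to `1`, and `α²`-close to `1 + a`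
  have hbd := fun b => norm_coe_cand_sub_one_le k hk A hA hM hM1 b
  set δ : ℝ := 2 * α with hδ
  have hδ0 : 0 ≤ δ := by positivity
  have hUδ : ∀ b, ‖((U b : Matrix.specialUnitaryGroup n ℂ) : Matrix n n ℂ) - 1‖ ≤ δ := fun b => (hbd b).1
  -- the natural scale at level k is k-free: (d+1)·L^k·δ = 2(d+1)·C_S·M
  have hscale : ((P.d : ℝ) + 1) * (P.L : ℝ) ^ k * δ = (2 * (((P.d : ℝ) + 1) * (CS P * M))) := by
    rw [hδ, hα]; field_simp
  have hm' : (((P.d : ℝ) + 1) * ((18 : ℝ) ^ P.d * (2 + ((P.d : ℝ) + 1) * (18 : ℝ) ^ P.d)) * (324 * (((P.d + 2) * P.L : ℕ) : ℝ) ^ 2) / ((P.L : ℝ) * ((P.L : ℝ) - 1))) * (((P.d : ℝ) + 1) * (P.L : ℝ) ^ k * δ) ≤ 1 := by rw [hscale]; exact hm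
  have h32' : 32 * (((P.d + 2) * P.L : ℕ) : ℝ) * (((P.d : ℝ) + 1) * (P.L : ℝ) ^ k * δ) ≤ 1 := by rw [hscale]; exact h32
  have hN' : 4 * (((P.d + 2) * P.L : ℕ) : ℝ) * (((P.d : ℝ) + 1) * (P.L : ℝ) ^ k * δ) < deltaSU n := by rw [hscale]; exact hN
  -- R1-allL at s = k
  have R1 := norm_iter_sub_one_sub_iterLin_le_uniform_allL (P := P) (n := n) linAvgIterM (fun Y => linAvgIterM_zero Y) (fun i Y c => linAvgIterM_succ i Y c)
    U hδ0 hUδ k hk hm' h32' hN' k le_rfl c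
  obtain ⟨R1a, R1b⟩ := R1
  rw [hscale] at R1a R1b
  refine ⟨R1a, ?_⟩
  -- the linear term: `Q^{(k)}(U − 1) = Q^{(k)} a + Q^{(k)}(U − 1 − a) = A + Q^{(k)} r`
  set Y : PBond P 0 → Matrix n n ℂ := fun b => ((U b : Matrix.specialUnitaryGroup n ℂ) : Matrix n n ℂ) - 1 with hY
  set r : PBond P 0 → Matrix n n ℂ := fun b => Y b - a b with hr
  have hYsplit : Y = a + r := by funext b; simp only [hr, Pi.add_apply]; abel
  have hlin : linAvgIterM k Y c = A c + avgCLM P k r c := by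
    rw [hYsplit, ← avgCLM_apply, map_add, Pi.add_apply, avgCLM_apply, ha, linAvgIterM_liftSM k hk]
  -- size of `r` and of `Q^{(k)} r`
  have hrb : ∀ b, ‖r b‖ ≤ α ^ 2 := fun b => by
    simp only [hr, hY]
    exact (hbd b).2
  have hrpi : ‖r‖ ≤ α ^ 2 := (pi_norm_le_iff_of_nonneg (by positivity)).mpr hrb
  have hQr : ‖avgCLM P k r c‖ ≤ ((P.d : ℝ) + 1) * (P.L : ℝ) ^ k * α ^ 2 :=
    calc ‖avgCLM P k r c‖ ≤ ‖avgCLM P k r‖ := norm_le_pi_norm _ c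
      _ ≤ ‖(avgCLM P k : (PBond P 0 → Matrix n n ℂ) →L[ℝ] (PBond P k → Matrix n n ℂ))‖ * ‖r‖ := ContinuousLinearMap.le_opNorm _ _
      _ ≤ (((P.d : ℝ) + 1) * (P.L : ℝ) ^ k) * α ^ 2 := mul_le_mul (norm_avgCLM_le k) hrpi (norm_nonneg _) (by positivity)
  have hQr' : ((P.d : ℝ) + 1) * (P.L : ℝ) ^ k * α ^ 2 ≤ ((P.d : ℝ) + 1) * CS P ^ 2 * M ^ 2 := by
    rw [hα, div_pow]
    have e : ((P.d : ℝ) + 1) * (P.L : ℝ) ^ k * ((CS P * M) ^ 2 / ((P.L : ℝ) ^ k) ^ 2) = ((P.d : ℝ) + 1) * CS P ^ 2 * M ^ 2 / (P.L : ℝ) ^ k := by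
      field_simp
    rw [e]
    exact div_le_self (by positivity) hL1
  -- assemble (the big constant is generalised so the kernel never unfolds it)
  obtain ⟨C', hC'⟩ : ∃ x : ℝ, x = (((P.d : ℝ) + 1) * ((18 : ℝ) ^ P.d * (2 + ((P.d : ℝ) + 1) * (18 : ℝ) ^ P.d)) * (324 * (((P.d + 2) * P.L : ℕ) : ℝ) ^ 2) / ((P.L : ℝ) * ((P.L : ℝ) - 1))) := ⟨_, rfl⟩
  rw [← hC'] at R1b ⊢
  have e2 : ((Averaging.iter (fun i => blockAvg (P := P) (j := i) (expMeanLogSU (n := n))) k U c : Matrix.specialUnitaryGroup n ℂ) : Matrix n n ℂ) - 1 - A c =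
      (((Averaging.iter (fun i => blockAvg (P := P) (j := i) (expMeanLogSU (n := n))) k U c : Matrix.specialUnitaryGroup n ℂ) : Matrix n n ℂ) - 1 - linAvgIterM k Y c) +
        avgCLM P k r c := by
    rw [hlin]; abel
  rw [e2]
  calc ‖(((Averaging.iter (fun i => blockAvg (P := P) (j := i) (expMeanLogSU (n := n))) k U c : Matrix.specialUnitaryGroup n ℂ) : Matrix n n ℂ) - 1 - linAvgIterM k Y c) + avgCLM P k r c‖
      ≤ ‖((Averaging.iter (fun i => blockAvg (P := P) (j := i) (expMeanLogSU (n := n))) k U c : Matrix.specialUnitaryGroup n ℂ) : Matrix n n ℂ) - 1 - linAvgIterM k Y c‖ + ‖avgCLM P k r c‖ :=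
        norm_add_le _ _
    _ ≤ C' * (2 * (((P.d : ℝ) + 1) * (CS P * M))) ^ 2 + ((P.d : ℝ) + 1) * CS P ^ 2 * M ^ 2 := add_le_add R1b (hQr.trans hQr')
    _ = (C' * (2 * (((P.d : ℝ) + 1) * CS P)) ^ 2 + ((P.d : ℝ) + 1) * CS P ^ 2) * M ^ 2 := by ring

include hk in
/-- ★★★ **THE SMOOTH-LIFT CANDIDATE EXISTS, AT EVERY BLOCK SIZE `L ≥ 2`** (★w2 g2's `exists_smoothLiftCandidate` without `d + 2 ≤ L`): for `𝔰𝔲(n)`-valued coarse `A` with `‖A‖ ≤ M`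
small (the k-free rows above and `4·C_S·M ≤ 1`) there is a finest `SU(n)` field with (i) bond variables within `2C_S M/L^k` of `1`, (ii) ALL finest plaquettes within
`(4·18^d·M + 16(C_S M)²)/(L^k)²` of `1`, (iii) `k`-fold (0.4) averages `1 + A + O(M²)` bond by bond with a `k`-free, `L`-threshold-free constant.
[cite: Balaban1985Variational, Thm 1 (8) p.279; Balaban1985Averaging, Prop. 4 (134)–(135) p.38] -/
theorem exists_smoothLiftCandidate_allL (A : PBond P k → Matrix n n ℂ) (hA : ∀ c, A c ∈ lieSU n) {M : ℝ} (hM : ∀ c, ‖A c‖ ≤ M) (hM4 : 4 * (CS P * M) ≤ 1)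
    (hm : (((P.d : ℝ) + 1) * ((18 : ℝ) ^ P.d * (2 + ((P.d : ℝ) + 1) * (18 : ℝ) ^ P.d)) * (324 * (((P.d + 2) * P.L : ℕ) : ℝ) ^ 2) / ((P.L : ℝ) * ((P.L : ℝ) - 1))) * (2 * (((P.d : ℝ) + 1) * (CS P * M))) ≤ 1)
    (h32 : 32 * (((P.d + 2) * P.L : ℕ) : ℝ) * (2 * (((P.d : ℝ) + 1) * (CS P * M))) ≤ 1)
    (hN : 4 * (((P.d + 2) * P.L : ℕ) : ℝ) * (2 * (((P.d : ℝ) + 1) * (CS P * M))) < deltaSU n) :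
    ∃ U : GaugeField P 0 (Matrix.specialUnitaryGroup n ℂ),
      (∀ b, ‖((U b : Matrix.specialUnitaryGroup n ℂ) : Matrix n n ℂ) - 1‖ ≤ 2 * (CS P * M / (P.L : ℝ) ^ k)) ∧
      (∀ q : Plaq P 0, GaugeGroup.dist1 (GaugeField.plaqHol U q) ≤ 4 * (18 : ℝ) ^ P.d * M / ((P.L : ℝ) ^ k) ^ 2 + 16 * (CS P * M / (P.L : ℝ) ^ k) ^ 2) ∧
      ∀ c : PBond P k, ‖((Averaging.iter (fun i => blockAvg (P := P) (j := i) (expMeanLogSU (n := n))) k U c : Matrix.specialUnitaryGroup n ℂ) : Matrix n n ℂ) - 1 - A c‖ ≤ ((((P.d : ℝ) + 1) * ((18 : ℝ) ^ P.d * (2 + ((P.d : ℝ) + 1) * (18 : ℝ) ^ P.d)) * (324 * (((P.d + 2) * P.L : ℕ) : ℝ) ^ 2) / ((P.L : ℝ) * ((P.L : ℝ) - 1))) * (2 * (((P.d : ℝ) + 1) * CS P)) ^ 2 + ((P.d : ℝ) + 1) * CS P ^ 2) * M ^ 2 := by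
  have hM1 : CS P * M ≤ 1 := by
    have : 0 ≤ CS P * M := by
      have hM0 : 0 ≤ M := (norm_nonneg _).trans (hM ⟨fun _ => 0, ⟨0, P.hd⟩⟩)
      exact mul_nonneg (CS_nonneg P) hM0
    linarith
  exact ⟨cand k A hA, fun b => (norm_coe_cand_sub_one_le k hk A hA hM hM1 b).1, fun q => dist1_plaqHol_cand_le k hk A hA hM hM4 q,
    fun c => (norm_iter_cand_sub_one_sub_le_allL k hk A hA hM hM1 hm h32 hN c).2⟩

end Summit.QuantumFields.YangMills.Theorems.SmoothLiftCandidate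

end
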